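import Literature.Probability.NegativeDependence.NegativeAssociationHierarchy
import HarnessLib

/-!
# NA does not imply NLC, even for symmetric measures (Borcea–Brändén–Liggett, Example 2.2)

J. Borcea, P. Brändén, T. M. Liggett, *Negative dependence and the geometry of polynomials*, J. Amer. Math. Soc.
22 (2009) 521–567 (arXiv:0707.2340, held `paper:arxiv-0707.2340`), §2.1 p. 7. Verbatim:

> We note that NA can fail to imply NLC even for symmetric measures:
> **Example 2.2.** Let as before `e_k`, `0 ≤ k ≤ n`, be the `k`-th elementary symmetric function in `n`
> variables and consider the measure `μ ∈ 𝔓_3` with generating polynomial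
> `g_μ(z_1,z_2,z_3) = (1/15)[3 + 2e_1(z_1,z_2,z_3) + 2e_2(z_1,z_2,z_3)]`. It is not difficult to check that `μ` is NA
> but not NLC.

(Pemantle [Pemantle2000, §2.3 Example 2] makes the same point — "the lowest vertical implication in Figure 1 is
strict" — with a different measure.)

## The check, as formalized

`μ = ex22` is the weight `S ↦ q_{|S|}` on `2^{[3]}` with `q = (3, 2, 2, 0)` (the factor `1/15` is dropped; NA
and NLC are homogeneous in `μ`). *Not NLC*: `μ({1,2}) μ(∅) = 6 > 4 = μ({1}) μ({2})`. *NA* (`IsNegAssoc`, Def. 2.7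
in `NegativeAssociationHierarchy.lean`): if `F`, `G` are increasing and depend on disjoint `E₁, E₂ ⊆ [3]` then one
of `E₁, E₂` has at most one element; a function depending on `∅` is constant (equality), and one depending on
`{e}` is `a + b·1_{e ∈ S}` with `b ≥ 0`, so NA reduces to `E[X_e G] μ(Ω) ≤ E[X_e] E[G]` for `G` increasing and
ignoring `e`; writing `{e}ᶜ = {f, g}` and summing over `T ⊆ {f,g}` this is
`15(2G(∅) + 2G(f) + 2G(g)) ≤ 6(5G(∅) + 4G(f) + 4G(g) + 2G(fg))`, i.e. `6G(f) + 6G(g) ≤ 12 G(fg)`.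

## Contents

* `ex22Seq`, `ex22`, `ex22_nonneg`, `isExchangeable_ex22`, **`not_isNLC_ex22`**;
* `sum_univ_eq_sum_powerset_erase`, `sum_powerset_pair`, `ex22_x_negCorr` (the displayed inequality),
  `negAssoc_ex22_of_card_le_one`, **`isNegAssoc_ex22`**, **`BorceaBrandenLiggett_example_2_2`**.

## References

* [BorceaBrandenLiggett2007] J. Borcea, P. Brändén, T. M. Liggett, Negative dependence and the geometry of
  polynomials, J. Amer. Math. Soc. 22 (2009); arXiv:0707.2340 — §2.1 Example 2.2, Def. 2.7, Fig. 1.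
* [Pemantle2000] R. Pemantle, Towards a theory of negative dependence, J. Math. Phys. 41 (2000) — §2.3 Example 2.
-/

noncomputable section

open Finset
open Literature.Combinatorics.Sahi2008

namespace Literature.Probability.NegativeDependence

/-! ## §1 The measure and "not NLC" -/

/-- The profile `(3, 2, 2, 0)` of `15 g_μ = 3 + 2e_1 + 2e_2`. [cite: BorceaBrandenLiggett2007, §2.1 Example 2.2] -/
def ex22Seq : ℕ → ℝ
  | 0 => 3
  | 1 => 2
  | 2 => 2
  | _ => 0

/-- **The measure of Example 2.2** (times `15`): `μ(S) = q_{|S|}`, `q = (3,2,2,0)`, on `2^{[3]}`.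
[cite: BorceaBrandenLiggett2007, §2.1 Example 2.2] -/
def ex22 : Finset (Fin 3) → ℝ := fun S => ex22Seq S.card

/-- Unfolding. [cite: BorceaBrandenLiggett2007, §2.1 Example 2.2] -/
theorem ex22_apply (S : Finset (Fin 3)) : ex22 S = ex22Seq S.card := rfl

/-- The values. [cite: BorceaBrandenLiggett2007, §2.1 Example 2.2] -/
theorem ex22Seq_values : ex22Seq 0 = 3 ∧ ex22Seq 1 = 2 ∧ ex22Seq 2 = 2 ∧ ex22Seq 3 = 0 := ⟨rfl, rfl, rfl, rfl⟩

/-- Nonnegativity of the profile. [cite: BorceaBrandenLiggett2007, §2.1 Example 2.2] -/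
theorem ex22Seq_nonneg (k : ℕ) : 0 ≤ ex22Seq k := by
  rcases k with _ | _ | _ | k <;> simp [ex22Seq]

/-- Nonnegativity. [cite: BorceaBrandenLiggett2007, §2.1 Example 2.2] -/
theorem ex22_nonneg (S : Finset (Fin 3)) : 0 ≤ ex22 S := ex22Seq_nonneg _

/-- The measure is symmetric. [cite: BorceaBrandenLiggett2007, §2.1 Example 2.2 ("even for symmetric
measures")] -/
theorem isExchangeable_ex22 : IsExchangeable ex22 := isExchangeable_card ex22Seq

/-- **Example 2.2, first half: `μ` is not NLC** (`μ({1,2}) μ(∅) = 6 > 4 = μ({1}) μ({2})`).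
[cite: BorceaBrandenLiggett2007, §2.1 Example 2.2] -/
theorem not_isNLC_ex22 : ¬ IsNLC ex22 := by
  intro h
  have key := h {0} {1}
  have h01 : (0 : Fin 3) ≠ 1 := by decide
  rw [← Finset.insert_eq, Finset.singleton_inter_of_notMem (by rwa [Finset.mem_singleton]), ex22_apply,
    ex22_apply, ex22_apply, ex22_apply, Finset.card_pair h01, Finset.card_empty, Finset.card_singleton,
    Finset.card_singleton] at key
  norm_num [ex22Seq] at key

/-! ## §2 Negative association -/

/-- Splitting a sum over `2^{[3]}` along `e`: `Σ_S φ(S) = Σ_{T ⊆ [3]∖e} (φ(T) + φ(T ∪ e))`.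
[cite: BorceaBrandenLiggett2007, §2.1 Example 2.2 ("not difficult to check")] -/
theorem sum_univ_eq_sum_powerset_erase {α : Type*} [Fintype α] [DecidableEq α] (e : α) (φ : Finset α → ℝ) :
    ∑ S : Finset α, φ S = ∑ T ∈ (Finset.univ.erase e).powerset, (φ T + φ (insert e T)) := by
  rw [← Finset.powerset_univ, ← Finset.insert_erase (Finset.mem_univ e),
    Finset.sum_powerset_insert (Finset.notMem_erase e _), Finset.insert_erase (Finset.mem_univ e),
    Finset.sum_add_distrib]

/-- The four subsets of a pair. [cite: BorceaBrandenLiggett2007, §2.1 Example 2.2 ("not difficult to check")] -/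
theorem sum_powerset_pair {α : Type*} [DecidableEq α] {f g : α} (hfg : f ≠ g) (φ : Finset α → ℝ) :
    ∑ T ∈ ({f, g} : Finset α).powerset, φ T = φ ∅ + φ {f} + φ {g} + φ {f, g} := by
  have hp : ({g} : Finset α).powerset = {∅, {g}} := by
    ext T
    rw [Finset.mem_powerset, Finset.subset_singleton_iff, Finset.mem_insert, Finset.mem_singleton]
  have hne : (∅ : Finset α) ≠ {g} := (Finset.singleton_ne_empty g).symm
  rw [Finset.sum_powerset_insert (by rwa [Finset.mem_singleton]), hp, Finset.sum_pair hne, Finset.sum_pair hne,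
    show insert f (∅ : Finset α) = {f} from rfl]
  ring

/-- **The displayed inequality**: for `G` increasing and ignoring `e`, `E[X_e G] μ(Ω) ≤ E[X_e] E[G]`
(`15(2G(∅)+2G(f)+2G(g)) ≤ 6(5G(∅)+4G(f)+4G(g)+2G(fg))`). [cite: BorceaBrandenLiggett2007, §2.1 Example 2.2] -/
theorem ex22_x_negCorr (e : Fin 3) {G : Finset (Fin 3) → ℝ} (hG : Monotone G) (hGe : Ignores G e) :
    ex ex22 ((fun S => if e ∈ S then (1 : ℝ) else 0) * G) * mass ex22 ≤
      ex ex22 (fun S => if e ∈ S then (1 : ℝ) else 0) * ex ex22 G := by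
  -- `{e}ᶜ = {f, g}`
  have hR : (Finset.univ.erase e).card = 2 := by
    rw [Finset.card_erase_of_mem (Finset.mem_univ e), Finset.card_univ, Fintype.card_fin]
  obtain ⟨f, g, hfg, hRfg⟩ := Finset.card_eq_two.1 hR
  have hf : f ≠ e ∧ g ≠ e := by
    constructor
    · intro h; have := Finset.mem_insert_self f {g}; rw [← hRfg, h] at this; exact Finset.notMem_erase e _ this
    · intro h; have : g ∈ ({f, g} : Finset (Fin 3)) := by simp
      rw [← hRfg, h] at this; exact Finset.notMem_erase e _ this
  have hef : e ∉ ({f} : Finset (Fin 3)) := by rw [Finset.mem_singleton]; exact fun h => hf.1 h.symm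
  have heg : e ∉ ({g} : Finset (Fin 3)) := by rw [Finset.mem_singleton]; exact fun h => hf.2 h.symm
  have hefg : e ∉ ({f, g} : Finset (Fin 3)) := by
    rw [Finset.mem_insert, Finset.mem_singleton, not_or]; exact ⟨fun h => hf.1 h.symm, fun h => hf.2 h.symm⟩
  -- the values of `μ`
  have v0 : ex22 ∅ = 3 := by rw [ex22_apply, Finset.card_empty]; rfl
  have v1 : ∀ a : Fin 3, ex22 {a} = 2 := fun a => by rw [ex22_apply, Finset.card_singleton]; rfl
  have v2 : ∀ {a : Fin 3} {T : Finset (Fin 3)}, a ∉ T → T.card = 1 → ex22 (insert a T) = 2 := fun ha hT => by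
    rw [ex22_apply, Finset.card_insert_of_notMem ha, hT]; rfl
  have v3 : ex22 (insert e {f, g}) = 0 := by
    rw [ex22_apply, Finset.card_insert_of_notMem hefg, Finset.card_pair hfg]; rfl
  have vfg : ex22 {f, g} = 2 := by rw [ex22_apply, Finset.card_pair hfg]; rfl
  have vef : ex22 (insert e {f}) = 2 := v2 hef (Finset.card_singleton f)
  have veg : ex22 (insert e {g}) = 2 := v2 heg (Finset.card_singleton g)
  have ve : ex22 (insert e ∅) = 2 := by rw [show insert e (∅ : Finset (Fin 3)) = {e} from rfl]; exact v1 e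
  -- `G` ignores `e` and is increasing
  have hGi : ∀ T, G (insert e T) = G T := hGe
  have hGf : G {f} ≤ G {f, g} := hG (by intro x hx; rw [Finset.mem_singleton] at hx; subst hx; simp)
  have hGg : G {g} ≤ G {f, g} := hG (by intro x hx; rw [Finset.mem_singleton] at hx; subst hx; simp)
  -- the four sums
  rw [ex_def, ex_def, ex_def, mass_def, sum_univ_eq_sum_powerset_erase e, sum_univ_eq_sum_powerset_erase e,
    sum_univ_eq_sum_powerset_erase e, sum_univ_eq_sum_powerset_erase e, hRfg, sum_powerset_pair hfg,
    sum_powerset_pair hfg, sum_powerset_pair hfg, sum_powerset_pair hfg]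
  simp only [Pi.mul_apply, Finset.mem_insert_self, if_true, hGi, v0, v1, vfg, vef, veg, ve, v3,
    if_neg (Finset.notMem_empty e), if_neg hef, if_neg heg, if_neg hefg]
  nlinarith [hGf, hGg]

/-- NA when `F` depends on at most one coordinate. [cite: BorceaBrandenLiggett2007, §2.1 Example 2.2] -/
theorem negAssoc_ex22_of_card_le_one {F G : Finset (Fin 3) → ℝ} (hF : Monotone F) (hG : Monotone G)
    {E₁ E₂ : Finset (Fin 3)} (hFE : DeterminedBy F E₁) (hGE : DeterminedBy G E₂) (hdisj : Disjoint E₁ E₂)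
    (hcard : E₁.card ≤ 1) : ex ex22 (F * G) * mass ex22 ≤ ex ex22 F * ex ex22 G := by
  rcases Nat.le_one_iff_eq_zero_or_eq_one.1 hcard with h0 | h1
  · -- `F` is constant
    rw [Finset.card_eq_zero] at h0
    have hc : ∀ S, F S = F ∅ := fun S => hFE S ∅ (by rw [h0, Finset.inter_empty, Finset.inter_empty])
    have e1 : ex ex22 (F * G) = F ∅ * ex ex22 G := by
      rw [ex_def, ex_def, Finset.mul_sum]
      exact Finset.sum_congr rfl fun S _ => by rw [Pi.mul_apply, hc S]; ring
    have e2 : ex ex22 F = F ∅ * mass ex22 := by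
      rw [ex_def, mass_def, Finset.mul_sum]
      exact Finset.sum_congr rfl fun S _ => by rw [hc S, mul_comm]
    rw [e1, e2]
    exact le_of_eq (by ring)
  · -- `F = a + b 1_{e ∈ S}`, `b ≥ 0`
    obtain ⟨e, hE⟩ := Finset.card_eq_one.1 h1
    have hc : ∀ S, F S = if e ∈ S then F {e} else F ∅ := fun S => by
      split_ifs with he
      · exact hFE S {e} (by rw [hE, Finset.inter_self, Finset.inter_singleton_of_mem he])
      · exact hFE S ∅ (by rw [hE, Finset.inter_singleton_of_notMem he, Finset.empty_inter])
    have hb : 0 ≤ F {e} - F ∅ := sub_nonneg.2 (hF (Finset.empty_subset _))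
    have hGe : Ignores G e := hGE.ignores (Finset.disjoint_left.1 hdisj (by rw [hE]; exact Finset.mem_singleton_self e))
    have key := ex22_x_negCorr e hG hGe
    have hpt : ∀ S, F S = F ∅ + (F {e} - F ∅) * (if e ∈ S then (1 : ℝ) else 0) := fun S => by
      rw [hc S]; split_ifs <;> ring
    have e1 : ex ex22 (F * G) = F ∅ * ex ex22 G +
        (F {e} - F ∅) * ex ex22 ((fun S => if e ∈ S then (1 : ℝ) else 0) * G) := by
      rw [ex_def, ex_def, ex_def, Finset.mul_sum, Finset.mul_sum, ← Finset.sum_add_distrib]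
      exact Finset.sum_congr rfl fun S _ => by rw [Pi.mul_apply, Pi.mul_apply, hpt S]; ring
    have e2 : ex ex22 F = F ∅ * mass ex22 + (F {e} - F ∅) * ex ex22 (fun S => if e ∈ S then (1 : ℝ) else 0) := by
      rw [ex_def, ex_def, mass_def, Finset.mul_sum, Finset.mul_sum, ← Finset.sum_add_distrib]
      exact Finset.sum_congr rfl fun S _ => by rw [hpt S]; ring
    rw [e1, e2]
    nlinarith [mul_le_mul_of_nonneg_left key hb]

/-- **Example 2.2, second half: `μ` is NA.** [cite: BorceaBrandenLiggett2007, §2.1 Example 2.2] -/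
theorem isNegAssoc_ex22 : IsNegAssoc ex22 := by
  intro F G hF hG E₁ E₂ hFE hGE hdisj
  by_cases h1 : E₁.card ≤ 1
  · exact negAssoc_ex22_of_card_le_one hF hG hFE hGE hdisj h1
  · have h2 : E₂.card ≤ 1 := by
      have := Finset.card_union_of_disjoint hdisj
      have hle : (E₁ ∪ E₂).card ≤ 3 := (Finset.card_le_univ _).trans (by rw [Fintype.card_fin])
      omega
    have key := negAssoc_ex22_of_card_le_one hG hF hGE hFE hdisj.symm h2
    rw [mul_comm F G, mul_comm (ex ex22 F)]
    exact key

/-- **Borcea–Brändén–Liggett, Example 2.2: NA does not imply NLC, even for symmetric measures** (so the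
bottom vertical arrow of Fig. 1 is strict). [cite: BorceaBrandenLiggett2007, §2.1 Example 2.2; Pemantle2000, §2.3
Example 2] -/
theorem BorceaBrandenLiggett_example_2_2 :
    ∃ μ : Finset (Fin 3) → ℝ, (∀ S, 0 ≤ μ S) ∧ IsExchangeable μ ∧ IsNegAssoc μ ∧ ¬ IsNLC μ :=
  ⟨ex22, ex22_nonneg, isExchangeable_ex22, isNegAssoc_ex22, not_isNLC_ex22⟩

/-- In particular the measure is not h-NLC (h-NLC ⟹ NLC), although it is NA. [cite: BorceaBrandenLiggett2007, §2.1
Example 2.2, Fig. 1] -/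
theorem not_isHNLC_ex22 : ¬ IsHNLC ex22 := fun h => not_isNLC_ex22 h.isNLC

end Literature.Probability.NegativeDependence

end
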